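import Literature.NumberTheory.Automorphic.QuaternionAdelicUnitsAwayFromPlaces
import Literature.NumberTheory.Automorphic.GLnTrivialAtAwayUnits
import Literature.NumberTheory.Automorphic.QuaternionNormEquationAdelic
import Literature.NumberTheory.Automorphic.QuaternionSplitMatrixModel
import HarnessLib

/-!
# `G'^S ≅ G^S`: a quaternion algebra splits over the adeles away from its ramified places, and the
# units of `D_𝔸` trivial at `S ⊇ Ram(D)` are `GL₂` of the adeles away from `S`
(Gelbart, *Automorphic forms on adele groups* (1975), §10, p. 153 and p. 155: "since `Z = Z'`,
`G_S = G'_S` [the groups away from the ramified set coincide] …"; Remark 10.7 (i))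

Topic `NumberTheory/Automorphic`; theorems only (the isomorphisms are asserted as `Nonempty`, being
built from chosen data: a presentation `D ≃ ℍ[K,a,b]` and an adelic solution of `s² - a t² = b`); no
definition, no named fact, no instance.

Let `D` be a quaternion algebra over the number field `K`, **unramified at the infinite places**
(Gelbart's standing assumption (i) of Remark 10.7, p. 155), and `S` a finite set of finite places
containing `Ram_f(D)`. Writing `D ≃ ℍ[K,a,b]` (`IsQuaternionAlgebra.exists_algEquiv_quaternionAlgebra`)
and choosing adeles `s, t` with `s² - a t² = b` at all infinite places and all finite `v ∉ S`
(`exists_adele_sq_sub_mul_sq_of_ramifiedPlaces_subset`, `QuaternionNormEquationAdelic`), the images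
`s̄, t̄` in the ring `𝔸_K^S = AdeleAway K S = 𝔸_K ⧸ (e_S)` of adeles away from `S`
(`AdeleAwayFromPlaces`) satisfy `s̄² - a t̄² = b` exactly (`AdeleAway.mk_eq_mk_iff_components`), so
`𝔸_K^S ⊗_K D ≃ 𝔸_K^S ⊗_K ℍ[K,a,b] ≃ ℍ[𝔸_K^S, a, b] ≃ M₂(𝔸_K^S)` (Mathlib `Algebra.TensorProduct.congr`,
`ScalarExtension.nonempty_algEquiv_quaternionAlgebra`, `QuaternionAlgebra.splitEquiv` of
`QuaternionSplitMatrixModel` over the commutative ring `𝔸_K^S`, `2ab ∈ (𝔸_K^S)ˣ`):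

* `Quat.nonempty_algEquiv_adeleAway_matrix` — **`𝔸_K^S ⊗_K D ≃ₐ[𝔸_K^S] M₂(𝔸_K^S)`**;
* `Quat.nonempty_units_continuousMulEquiv_adeleAway_GL` — **`(𝔸_K^S ⊗_K D)ˣ ≃ₜ* GL₂(𝔸_K^S)`** (an
  algebra isomorphism of finite modules with their module topologies is a homeomorphism);
* `Quat.exists_trivialAt_continuousMulEquiv_trivialAt` — **`G'^S ≅ G^S`**: a splitting `Ψ` and an
  isomorphism of topological groups `Φ : D^{S,×} ≃ₜ* G^S` between the units of `D_𝔸` trivial at `S`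
  and the elements of `GL₂(𝔸_K)` trivial at `S`, compatible: `Φ(x) mod e_S = Ψ((mk ⊗ 1) x)`
  (`Quat.trivialAtEquivAwayUnits`, `GLn.trivialAtEquivAwayGL`); `Nonempty` form
  `Quat.nonempty_trivialAt_continuousMulEquiv_trivialAt`.

Part of the inline (D-0026) decomposition of
`Literature.NumberTheory.Automorphic.strong_multiplicity_one_quaternionUnits` (the comparison
(10.14) = (10.15) uses the same test function `f` on `G'^S = G^S`).

## References

* S. Gelbart, *Automorphic forms on adele groups*, Ann. of Math. Studies 83 (1975), §10, pp. 153, 155,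
  Remark 10.7 [Gelbart1975].
* M.-F. Vignéras, *Arithmétique des algèbres de quaternions*, LNM 800 (1980), Ch. I §2 Cor. 2.4,
  Ch. III §3 [VignerasLNM800].
-/

noncomputable section

open scoped TensorProduct Quaternion
open NumberField IsDedekindDomain Topology

universe u

namespace Literature.NumberTheory.Automorphic

section Splitting

variable (K : Type) [Field K] [NumberField K] (D : Type u) [Ring D] [Algebra K D] [IsQuaternionAlgebra K D]
  (S : Finset (HeightOneSpectrum (𝓞 K)))

/-- **`𝔸_K^S ⊗_K D ≃ₐ[𝔸_K^S] M₂(𝔸_K^S)`** for a quaternion algebra `D` unramified at infinity and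
`S ⊇ Ram_f(D)`: `D` splits over the adeles away from `S`. [cite: Gelbart1975, §10 p. 153 (G^S), Remark 10.7 (i)]
[cite: VignerasLNM800, Ch. I §2 Cor. 2.4] -/
theorem Quat.nonempty_algEquiv_adeleAway_matrix (hS : ramifiedPlaces K D ⊆ (S : Set (HeightOneSpectrum (𝓞 K))))
    (hi : ramifiedInfinitePlaces K D = ∅) :
    Nonempty (ScalarExtension K (AdeleAway K S) D ≃ₐ[AdeleAway K S] Matrix (Fin 2) (Fin 2) (AdeleAway K S)) := by
  haveI : NeZero (2 : K) := ⟨two_ne_zero⟩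
  obtain ⟨a, b, ha, hb, ⟨e⟩⟩ := IsQuaternionAlgebra.exists_algEquiv_quaternionAlgebra K D
  obtain ⟨s, t, hsti, hstf⟩ := exists_adele_sq_sub_mul_sq_of_ramifiedPlaces_subset K D ha hb e S hS hi
  set R := AdeleAway K S with hR
  -- in `𝔸_K^S` the equation holds exactly
  have hst : AdeleAway.mk K S s ^ 2 - algebraMap K R a * AdeleAway.mk K S t ^ 2 = algebraMap K R b := by
    rw [AdeleAway.algebraMap_eq, AdeleAway.algebraMap_eq, ← map_pow, ← map_pow, ← map_mul, ← map_sub,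
      AdeleAway.mk_eq_mk_iff_components]
    exact ⟨funext hsti, hstf⟩
  -- `2ab` is a unit
  have hδ : IsUnit (2 * algebraMap K R a * algebraMap K R b) := by
    have h2 : IsUnit (2 : R) := by
      rw [show (2 : R) = algebraMap K R 2 by rw [map_ofNat]]
      exact AdeleAway.isUnit_algebraMap K S two_ne_zero
    exact (h2.mul (AdeleAway.isUnit_algebraMap K S ha)).mul (AdeleAway.isUnit_algebraMap K S hb)
  -- the chain of isomorphisms
  obtain ⟨e₁⟩ := ScalarExtension.nonempty_algEquiv_quaternionAlgebra K R a b
  have e₀ : ScalarExtension K R D ≃ₐ[R] ScalarExtension K R ℍ[K,a,b] :=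
    (Algebra.TensorProduct.congr (AlgEquiv.refl : R ≃ₐ[R] R) e : R ⊗[K] D ≃ₐ[R] R ⊗[K] ℍ[K,a,b])
  exact ⟨(e₀.trans e₁).trans (QuaternionAlgebra.splitEquiv hst hδ)⟩

omit [NumberField K] [IsQuaternionAlgebra K D] in
/-- An `R`-algebra isomorphism `R ⊗_K D ≃ M₂(R)` (module topology, resp. product topology) is a
homeomorphism, hence induces an isomorphism of topological groups on units. [folklore] -/
theorem Quat.nonempty_units_continuousMulEquiv_of_algEquiv {R : Type*} [CommRing R] [Algebra K R]
    [TopologicalSpace R] [IsTopologicalRing R]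
    (φ : ScalarExtension K R D ≃ₐ[R] Matrix (Fin 2) (Fin 2) R) :
    ∃ Φ : (ScalarExtension K R D)ˣ ≃ₜ* GL (Fin 2) R, ∀ u, (Φ u : Matrix (Fin 2) (Fin 2) R) = φ u := by
  haveI : IsModuleTopology R (Matrix (Fin 2) (Fin 2) R) := inferInstanceAs (IsModuleTopology R (Fin 2 → Fin 2 → R))
  haveI : ContinuousAdd (ScalarExtension K R D) := IsModuleTopology.toContinuousAdd R _
  have hφ : Continuous φ := IsModuleTopology.continuous_of_linearMap φ.toLinearEquiv.toLinearMap
  have hφs : Continuous φ.symm := IsModuleTopology.continuous_of_linearMap φ.symm.toLinearEquiv.toLinearMap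
  refine ⟨{ Units.mapEquiv φ.toMulEquiv with
      continuous_toFun := Continuous.units_map (φ.toMulEquiv.toMonoidHom) hφ
      continuous_invFun := ?_ }, fun u => rfl⟩
  change Continuous (Units.mapEquiv φ.toMulEquiv).symm
  exact Continuous.units_map (φ.symm.toMulEquiv.toMonoidHom) hφs

/-- **`(𝔸_K^S ⊗_K D)ˣ ≃ₜ* GL₂(𝔸_K^S)`** for `D` unramified at infinity and `S ⊇ Ram_f(D)`.
[cite: Gelbart1975, §10 p. 153 (G^S), Remark 10.7 (i)] -/
theorem Quat.nonempty_units_continuousMulEquiv_adeleAway_GL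
    (hS : ramifiedPlaces K D ⊆ (S : Set (HeightOneSpectrum (𝓞 K)))) (hi : ramifiedInfinitePlaces K D = ∅) :
    Nonempty ((ScalarExtension K (AdeleAway K S) D)ˣ ≃ₜ* GL (Fin 2) (AdeleAway K S)) := by
  obtain ⟨φ⟩ := Quat.nonempty_algEquiv_adeleAway_matrix K D S hS hi
  obtain ⟨Φ, -⟩ := Quat.nonempty_units_continuousMulEquiv_of_algEquiv K D φ
  exact ⟨Φ⟩

/-- Reduction modulo `e_S` of the inverse of `GLn.trivialAtEquivAwayGL`: `(E_S + (1 - E_S) σ(u)) mod e_S = u`.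
[folklore] -/
theorem GLn.map_mk_coe_trivialAtEquivAwayGL_symm (u : GL (Fin 2) (AdeleAway K S)) :
    (Units.val (show GL (Fin 2) (AdeleRing (𝓞 K) K) from
        (((GLn.trivialAtEquivAwayGL 2 K S).symm u : GLn.trivialAt 2 K S) : (AdelicGroupData.gl 2 K).Adelic))).map (AdeleAway.mk K S) =
      (u : Matrix (Fin 2) (Fin 2) (AdeleAway K S)) := by
  rw [GLn.coe_trivialAtEquivAwayGL_symm, ← GLn.awayProj_apply, map_add, map_mul,
    Literature.Topology.Algebra.map_idem (GLn.awayProj 2 K S) (GLn.awaySection 2 K S)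
      (fun M => GLn.awayProj_awaySection M) (fun M => GLn.awaySection_awayProj M),
    Literature.Topology.Algebra.map_one_sub_idem (GLn.awayProj 2 K S) (GLn.awaySection 2 K S)
      (fun M => GLn.awayProj_awaySection M) (fun M => GLn.awaySection_awayProj M),
    zero_add, one_mul]
  exact GLn.awayProj_awaySection _

/-- **`G'^S ≅ G^S`** (Gelbart (1975), §10, pp. 153, 155): for a quaternion algebra `D` over `K`
unramified at the infinite places and a finite set `S ⊇ Ram_f(D)` of finite places, there are a splitting
`Ψ : 𝔸_K^S ⊗_K D ≃ₐ[𝔸_K^S] M₂(𝔸_K^S)` and an isomorphism of topological groups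
`Φ : D^{S,×} ≃ₜ* G^S` between the units of `D_𝔸` trivial at `S` and the elements of `GL₂(𝔸_K)` trivial at
`S`, **compatible in the sense that `Φ(x) mod e_S = Ψ((mk ⊗ 1) x)`** — `Φ` is `Ψ` on units, read through
`D^{S,×} ≃ (𝔸_K^S ⊗_K D)ˣ` (`Quat.trivialAtEquivAwayUnits`) and `GL₂(𝔸_K^S) ≃ G^S` (`GLn.trivialAtEquivAwayGL`).
[cite: Gelbart1975, §10 pp. 153–155, Remark 10.7 (i)] -/
theorem Quat.exists_trivialAt_continuousMulEquiv_trivialAt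
    (hS : ramifiedPlaces K D ⊆ (S : Set (HeightOneSpectrum (𝓞 K)))) (hi : ramifiedInfinitePlaces K D = ∅) :
    ∃ (Ψ : ScalarExtension K (AdeleAway K S) D ≃ₐ[AdeleAway K S] Matrix (Fin 2) (Fin 2) (AdeleAway K S))
      (Φ : Quat.trivialAt K D S ≃ₜ* GLn.trivialAt 2 K S),
      ∀ x : Quat.trivialAt K D S,
        (Units.val (show GL (Fin 2) (AdeleRing (𝓞 K) K) from ((Φ x : GLn.trivialAt 2 K S) : (AdelicGroupData.gl 2 K).Adelic))).map
            (AdeleAway.mk K S) =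
          Ψ (Quat.awayProj K D S ((x : adelicUnits K D) : ScalarExtension K (AdeleRing (𝓞 K) K) D)) := by
  haveI : Module.Finite K D := inferInstance
  obtain ⟨Ψ⟩ := Quat.nonempty_algEquiv_adeleAway_matrix K D S hS hi
  obtain ⟨ΦU, hΦU⟩ := Quat.nonempty_units_continuousMulEquiv_of_algEquiv K D Ψ
  refine ⟨Ψ, ((Quat.trivialAtEquivAwayUnits K D S).trans ΦU).trans (GLn.trivialAtEquivAwayGL 2 K S).symm, fun x => ?_⟩
  change (Units.val (show GL (Fin 2) (AdeleRing (𝓞 K) K) from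
    (((GLn.trivialAtEquivAwayGL 2 K S).symm (ΦU (Quat.trivialAtEquivAwayUnits K D S x)) : GLn.trivialAt 2 K S) :
      (AdelicGroupData.gl 2 K).Adelic))).map (AdeleAway.mk K S) = _
  rw [GLn.map_mk_coe_trivialAtEquivAwayGL_symm, hΦU]
  rfl

/-- The `Nonempty` form: `D^{S,×}` and `G^S` are isomorphic topological groups. [cite: Gelbart1975, §10 pp. 153–155] -/
theorem Quat.nonempty_trivialAt_continuousMulEquiv_trivialAt
    (hS : ramifiedPlaces K D ⊆ (S : Set (HeightOneSpectrum (𝓞 K)))) (hi : ramifiedInfinitePlaces K D = ∅) :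
    Nonempty (Quat.trivialAt K D S ≃ₜ* GLn.trivialAt 2 K S) := by
  obtain ⟨-, Φ, -⟩ := Quat.exists_trivialAt_continuousMulEquiv_trivialAt K D S hS hi
  exact ⟨Φ⟩

end Splitting

end Literature.NumberTheory.Automorphic
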